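import Summits.CriticalPhenomena.PercolationContinuityZ3.Theorems.FK.MagnetizationLargeDeviations
import Summits.CriticalPhenomena.PercolationContinuityZ3.Theorems.FK.IsingPhaseDiagram
import HarnessLib

/-!
# THE EXPONENTIAL LAW OF LARGE NUMBERS FOR THE ISING MAGNETISATION DENSITY UNDER THE FINITE-VOLUME GIBBS STATES:
# NO DENSITY ABOVE `m*(β)` AT ANY TEMPERATURE, `M_N/|Λ_N| →exp ±m(β,|h|)` AT `h ≠ 0`, `→exp 0` WHEN `m*(β) = 0`,
# AND `→exp sign(h) m(β,|h|)` THROUGHOUT THE UNIQUENESS REGION `|𝒢(β,h)| = 1` (Ellis 2006, Thms. IV.5.5, V.6.1 (c)–(d))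

Claimed R42 (8)(c) in the cell INBOX at 2026-08-29T07:20:29Z by fkp-10a gen 359 (NEW CLAIM #1 of the gen), addressed to the lane under (ι) (coordinator fk-4 gen 293 CLOSED l.8789 06:52:14Z 2026-08-29; «(ι) RESUMES») and to the next seated fk-4 generation (ruling R172 requested); lineage row FO-10a-g359 (self-suggested), package g359-largedev, label LD-C.
Helper file of the `fk-continuity` build cell (bschramm lane; `--supports stmt-CriticalPhenomena-4575`); builds on
p205010 (kernel theorem, internal audit signed; external expert review pending). No definitions, no named facts, no
sorries; standard axioms. UNCONDITIONAL (nearest-neighbour Ising model on `ℤ^d`, boxes `Λ_N = {−N,…,N}^d`, EVERY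
boundary condition `bc`; `μ_N = μ^{bc}_{Λ_N;β,h}`, `M_N = Σ_{x∈Λ_N} σ_x`).

The one-sided field-derivatives of the pressure are `∂^±ψ/∂h (β,0) = ±β m*(β)` and `∂ψ/∂h (β,h) = β m(β,h)` at
`h > 0` (`PressureFieldDerivative`, Friedli–Velenik Prop. 3.29 / Thm. 3.43); fed into the exponential-concentration
theorems of `MagnetizationLargeDeviations` (Ellis Thm. II.6.3) they give, for `d ≥ 1`, `β > 0`, with constants
`c > 0` independent of the boundary condition and bounds holding eventually in `N` for each boundary condition:

* **`upper_tail_exp_decay_of_magnetizationInField_lt`** — `h ≥ 0`, every `m > m(β,h)`: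
  `μ^{bc}_{Λ_N;β,h}{M_N ≥ m|Λ_N|} ≤ e^{−c|Λ_N|}`; at `h = 0` (`upper_tail_exp_decay_of_spontaneousMagnetization_lt`,
  `lower_tail_exp_decay_of_lt_neg_spontaneousMagnetization`, **`measureReal_abs_sum_spinAt_ge_exp_decay_zero_field`**):
  AT EVERY TEMPERATURE the magnetisation density does not leave `[−m*(β), m*(β)]` except at volume-order exponential
  cost (Ellis Thm. V.6.1 (d), Note 13 to Ch. IV);
* `lower_tail_exp_decay_of_lt_magnetizationInField` (`h > 0`, `m < m(β,h)`); **`exp_concentration_pos_field`** /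
  `exp_concentration_neg_field` — THE EXPONENTIAL LAW OF LARGE NUMBERS `M_N/|Λ_N| →exp m(β,h)` at `h > 0`
  (`→exp −m(β,−h)` at `h < 0`), every boundary condition (Ellis Thm. V.6.1 (c), (4.32));
* **`exp_concentration_zero_field_of_spontaneousMagnetization_eq_zero`** — `M_N/|Λ_N| →exp 0` at `h = 0` whenever
  `m*(β) = 0`; `exp_concentration_zero_field_of_le_criticalBeta` — in particular for `d ≥ 2`, `0 < β ≤ β_c(d)`
  (the phase diagram file `IsingPhaseDiagram`: `m*(β) = 0` iff `|𝒢(β,0)| = 1` iff `β ≤ β_c`);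
* **`exp_concentration_of_hasUniqueGibbsMeasure`** — THROUGHOUT THE UNIQUENESS REGION `|𝒢(β,h)| = 1` (`d ≥ 1`,
  `β > 0`): `M_N/|Λ_N| →exp sign(h) · m(β,|h|)` under every boundary condition (uniqueness ⟺ differentiability of
  `ψ(β,·)` at `h`, `hasUniqueGibbsMeasure_iff_differentiableAt_pressure`); `exp_concentration_of_ne_zero_or_le_criticalBeta`
  — the same on `{h ≠ 0} ∪ {β ≤ β_c}` for `d ≥ 2`.

## References

* R. S. Ellis, *Entropy, Large Deviations, and Statistical Mechanics*, Springer (1985/2006), (2.31), Thm. II.6.3,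
  §IV.5 Thm. IV.5.5 (4.32), §V.6 Thm. V.6.1 (c)–(d) and the remark after it, Note 13 to Ch. IV. [Ellis2006]
* O. E. Lanford, *Entropy and equilibrium states in classical statistical mechanics*, LNP 20, Springer (1973),
  1–113. [Lanford1973]
* S. Friedli, Y. Velenik, *Statistical Mechanics of Lattice Systems*, CUP (2017), Prop. 3.29, Thm. 3.34,
  Thm. 3.43 / Cor. 3.44, Thm. 3.25. [FriedliVelenik2017]
-/

noncomputable section

namespace Summit.CriticalPhenomena.PercolationContinuityZ3.Theorems.FK

namespace IsingLargeDeviations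

open MeasureTheory ProbabilityTheory Filter Topology Finset Set
open Literature.Probability.LatticeModels

variable {d : ℕ}

/-! ### `h ≥ 0`: no density above `m(β,h)`; `h = 0`: none outside `[−m*, m*]` -/


/-- **NO MACROSCOPIC MAGNETISATION DENSITY ABOVE `m(β,h)` (`h ≥ 0`; at `h = 0`: ABOVE `m*(β)`, AT EVERY `β > 0`)**:
for `d ≥ 1`, `β > 0`, `h ≥ 0` and every `m > m(β,h)` there is `c > 0` such that for EVERY boundary condition,
eventually `μ^{bc}_{Λ_N;β,h}{M_N ≥ m|Λ_N|} ≤ e^{−c|Λ_N|}` (`∂⁺ψ/∂h = β m(β,h)`, resp. `β m*(β)` at `h = 0`).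
[cite: Ellis2006, Thm. V.6.1 (c)–(d) and the remark after it, Note 13 to Ch. IV; FriedliVelenik2017, Prop. 3.29 / Thm. 3.43] -/
theorem upper_tail_exp_decay_of_magnetizationInField_lt (hd : 1 ≤ d) {β : ℝ} (hβ : 0 < β) {h : ℝ} (hh : 0 ≤ h)
    {m : ℝ} (hm : magnetizationInField d β h < m) :
    ∃ c : ℝ, 0 < c ∧ ∀ bc : BoundaryCondition (Site d), ∀ᶠ N : ℕ in atTop,
      (isingMeasure (zdGraph d) (box d N) β h bc).real {σ | m * #(box d N) ≤ ∑ x ∈ box d N, spinAt x σ} ≤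
        Real.exp (-(c * #(box d N))) := by
  rcases hh.eq_or_lt with rfl | hpos
  · refine upper_tail_exp_decay_of_hasDerivWithinAt hβ.le
      (IsingSusceptibility.hasDerivWithinAt_pressure_field_zero (d := d) hd hβ.le) ?_
    rw [← magnetizationInField_zero]
    exact mul_lt_mul_of_pos_left hm hβ
  · exact upper_tail_exp_decay_of_hasDerivWithinAt hβ.le
      (IsingSusceptibility.hasDerivAt_pressure_field (d := d) hd hβ.le hpos).hasDerivWithinAt
      (mul_lt_mul_of_pos_left hm hβ)

/-- **AT `h = 0`, EVERY `β > 0`, EVERY `m > m*(β)`: `μ^{bc}_{Λ_N;β,0}{M_N ≥ m|Λ_N|} ≤ e^{−c|Λ_N|}`** eventually, every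
boundary condition. [cite: Ellis2006, Thm. V.6.1 (d) and Note 13 to Ch. IV; FriedliVelenik2017, Prop. 3.29] -/
theorem upper_tail_exp_decay_of_spontaneousMagnetization_lt (hd : 1 ≤ d) {β : ℝ} (hβ : 0 < β) {m : ℝ}
    (hm : spontaneousMagnetization d β < m) :
    ∃ c : ℝ, 0 < c ∧ ∀ bc : BoundaryCondition (Site d), ∀ᶠ N : ℕ in atTop,
      (isingMeasure (zdGraph d) (box d N) β 0 bc).real {σ | m * #(box d N) ≤ ∑ x ∈ box d N, spinAt x σ} ≤
        Real.exp (-(c * #(box d N))) :=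
  upper_tail_exp_decay_of_magnetizationInField_lt hd hβ le_rfl (by rwa [magnetizationInField_zero])

/-- **AT `h = 0`, EVERY `m < −m*(β)`: `μ^{bc}_{Λ_N;β,0}{M_N ≤ m|Λ_N|} ≤ e^{−c|Λ_N|}`** eventually, every boundary
condition (`∂⁻ψ/∂h (β,0) = −β m*(β)`). [cite: Ellis2006, Thm. V.6.1 (d) and Note 13 to Ch. IV; FriedliVelenik2017, Prop. 3.29] -/
theorem lower_tail_exp_decay_of_lt_neg_spontaneousMagnetization (hd : 1 ≤ d) {β : ℝ} (hβ : 0 < β) {m : ℝ}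
    (hm : m < -spontaneousMagnetization d β) :
    ∃ c : ℝ, 0 < c ∧ ∀ bc : BoundaryCondition (Site d), ∀ᶠ N : ℕ in atTop,
      (isingMeasure (zdGraph d) (box d N) β 0 bc).real {σ | ∑ x ∈ box d N, spinAt x σ ≤ m * #(box d N)} ≤
        Real.exp (-(c * #(box d N))) := by
  refine lower_tail_exp_decay_of_hasDerivWithinAt hβ.le
    (IsingSusceptibility.hasDerivWithinAt_pressure_field_zero_left (d := d) hd hβ.le) ?_
  have := mul_lt_mul_of_pos_left hm hβ
  linarith

/-- **AT `h > 0`, EVERY `m < m(β,h)`: `μ^{bc}_{Λ_N;β,h}{M_N ≤ m|Λ_N|} ≤ e^{−c|Λ_N|}`** eventually, every boundary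
condition (`ψ(β,·)` is differentiable at `h > 0` with derivative `β m(β,h)`).
[cite: Ellis2006, Thm. V.6.1 (c); FriedliVelenik2017, Thm. 3.43 / Cor. 3.44] -/
theorem lower_tail_exp_decay_of_lt_magnetizationInField (hd : 1 ≤ d) {β : ℝ} (hβ : 0 < β) {h : ℝ} (hh : 0 < h)
    {m : ℝ} (hm : m < magnetizationInField d β h) :
    ∃ c : ℝ, 0 < c ∧ ∀ bc : BoundaryCondition (Site d), ∀ᶠ N : ℕ in atTop,
      (isingMeasure (zdGraph d) (box d N) β h bc).real {σ | ∑ x ∈ box d N, spinAt x σ ≤ m * #(box d N)} ≤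
        Real.exp (-(c * #(box d N))) :=
  lower_tail_exp_decay_of_hasDerivWithinAt hβ.le
    (IsingSusceptibility.hasDerivAt_pressure_field (d := d) hd hβ.le hh).hasDerivWithinAt
    (mul_lt_mul_of_pos_left hm hβ)

/-- **THE EXPONENTIAL LAW OF LARGE NUMBERS AT `h > 0`: `M_N/|Λ_N| →exp m(β,h)`** (`d ≥ 1`, `β > 0`): for every
`ε > 0` there is `c > 0` such that for EVERY boundary condition, eventually
`μ^{bc}_{Λ_N;β,h}{ε ≤ |M_N/|Λ_N| − m(β,h)|} ≤ e^{−c|Λ_N|}`. [cite: Ellis2006, Thm. V.6.1 (c), Thm. IV.5.5 (4.32); FriedliVelenik2017, Thm. 3.43] -/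
theorem exp_concentration_pos_field (hd : 1 ≤ d) {β : ℝ} (hβ : 0 < β) {h : ℝ} (hh : 0 < h) {ε : ℝ}
    (hε : 0 < ε) :
    ∃ c : ℝ, 0 < c ∧ ∀ bc : BoundaryCondition (Site d), ∀ᶠ N : ℕ in atTop,
      (isingMeasure (zdGraph d) (box d N) β h bc).real
          {σ | ε ≤ |(∑ x ∈ box d N, spinAt x σ) / #(box d N) - magnetizationInField d β h|} ≤
        Real.exp (-(c * #(box d N))) := by
  have h1 := exp_concentration_of_hasDerivAt hd hβ (IsingSusceptibility.hasDerivAt_pressure_field (d := d) hd hβ.le hh) hε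
  rwa [mul_div_cancel_left₀ _ hβ.ne'] at h1

/-- **THE EXPONENTIAL LAW OF LARGE NUMBERS AT `h < 0`: `M_N/|Λ_N| →exp −m(β,−h)`** (`d ≥ 1`, `β > 0`), every
boundary condition. [cite: Ellis2006, Thm. V.6.1 (c); FriedliVelenik2017, §3.7.1 and Thm. 3.43] -/
theorem exp_concentration_neg_field (hd : 1 ≤ d) {β : ℝ} (hβ : 0 < β) {h : ℝ} (hh : h < 0) {ε : ℝ}
    (hε : 0 < ε) :
    ∃ c : ℝ, 0 < c ∧ ∀ bc : BoundaryCondition (Site d), ∀ᶠ N : ℕ in atTop,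
      (isingMeasure (zdGraph d) (box d N) β h bc).real
          {σ | ε ≤ |(∑ x ∈ box d N, spinAt x σ) / #(box d N) + magnetizationInField d β (-h)|} ≤
        Real.exp (-(c * #(box d N))) := by
  have h1 := exp_concentration_of_hasDerivAt hd hβ
    (IsingSusceptibility.hasDerivAt_pressure_field_of_neg (d := d) hd hβ.le hh) hε
  simp only [neg_div, mul_div_cancel_left₀ _ hβ.ne', sub_neg_eq_add] at h1
  exact h1

/-- **AT `h = 0`, EVERY `β > 0`, EVERY `m > m*(β)`: `μ^{bc}_{Λ_N;β,0}{|M_N| ≥ m|Λ_N|} ≤ e^{−c|Λ_N|}`** eventually, every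
boundary condition: the magnetisation density does not leave `[−m*(β), m*(β)]` at volume-order cost.
[cite: Ellis2006, Thm. V.6.1 (d) and Note 13 to Ch. IV] -/
theorem measureReal_abs_sum_spinAt_ge_exp_decay_zero_field (hd : 1 ≤ d) {β : ℝ} (hβ : 0 < β) {m : ℝ}
    (hm : spontaneousMagnetization d β < m) :
    ∃ c : ℝ, 0 < c ∧ ∀ bc : BoundaryCondition (Site d), ∀ᶠ N : ℕ in atTop,
      (isingMeasure (zdGraph d) (box d N) β 0 bc).real {σ | m * #(box d N) ≤ |∑ x ∈ box d N, spinAt x σ|} ≤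
        Real.exp (-(c * #(box d N))) := by
  obtain ⟨c₁, hc₁, h₁⟩ := upper_tail_exp_decay_of_spontaneousMagnetization_lt hd hβ hm
  obtain ⟨c₂, hc₂, h₂⟩ := lower_tail_exp_decay_of_lt_neg_spontaneousMagnetization hd hβ (m := -m) (by linarith)
  refine ⟨min c₁ c₂ / 2, by positivity, fun bc => ?_⟩
  filter_upwards [h₁ bc, h₂ bc, eventually_exp_add_exp_le hd hc₁ hc₂] with N hN₁ hN₂ hN
  have hsub : {σ : SpinConfig (Site d) | m * #(box d N) ≤ |∑ x ∈ box d N, spinAt x σ|} ⊆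
      {σ | m * #(box d N) ≤ ∑ x ∈ box d N, spinAt x σ} ∪ {σ | ∑ x ∈ box d N, spinAt x σ ≤ -m * #(box d N)} := by
    intro σ hσ
    simp only [mem_setOf_eq, Set.mem_union] at hσ ⊢
    rcases le_abs'.1 hσ with h1 | h1
    · right; linarith
    · left; exact h1
  exact ((measureReal_mono hsub).trans (measureReal_union_le _ _)).trans ((add_le_add hN₁ hN₂).trans hN)

/-- **THE EXPONENTIAL LAW OF LARGE NUMBERS AT `h = 0` WHEN `m*(β) = 0`: `M_N/|Λ_N| →exp 0`** (`d ≥ 1`, `β > 0`; in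
particular throughout the high-temperature phase), every boundary condition.
[cite: Ellis2006, Thm. IV.5.5 (4.32) and Thm. V.6.1 (c); FriedliVelenik2017, Thm. 3.34] -/
theorem exp_concentration_zero_field_of_spontaneousMagnetization_eq_zero (hd : 1 ≤ d) {β : ℝ} (hβ : 0 < β)
    (hm : spontaneousMagnetization d β = 0) {ε : ℝ} (hε : 0 < ε) :
    ∃ c : ℝ, 0 < c ∧ ∀ bc : BoundaryCondition (Site d), ∀ᶠ N : ℕ in atTop,
      (isingMeasure (zdGraph d) (box d N) β 0 bc).real
          {σ | ε ≤ |(∑ x ∈ box d N, spinAt x σ) / #(box d N)|} ≤ Real.exp (-(c * #(box d N))) := by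
  obtain ⟨c, hc, h⟩ := measureReal_abs_sum_spinAt_ge_exp_decay_zero_field hd hβ (m := ε) (by rwa [hm])
  refine ⟨c, hc, fun bc => ?_⟩
  filter_upwards [h bc] with N hN
  refine (measureReal_mono fun σ hσ => ?_).trans hN
  have hV : (0 : ℝ) < #(box d N) := by exact_mod_cast (box_nonempty d N).card_pos
  simp only [mem_setOf_eq] at hσ ⊢
  rwa [abs_div, abs_of_pos hV, le_div_iff₀ hV] at hσ

/-! ### The uniqueness region: `M_N/|Λ_N| →exp sign(h) · m(β,|h|)` whenever `|𝒢(β,h)| = 1` -/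

/-- **IN THE UNIQUENESS REGION THE MAGNETISATION DENSITY OBEYS AN EXPONENTIAL LAW OF LARGE NUMBERS UNDER EVERY BOUNDARY
CONDITION**: for `d ≥ 1`, `β > 0` and `|𝒢(β,h)| = 1`, for every `ε > 0` there is `c > 0` with
`μ^{bc}_{Λ_N;β,h}{ε ≤ |M_N/|Λ_N| − sign(h) m(β,|h|)|} ≤ e^{−c|Λ_N|}` eventually, every `bc` (uniqueness ⟺ `ψ(β,·)`
differentiable at `h`, with derivative `β sign(h) m(β,|h|)`). [cite: Ellis2006, Thm. V.6.1 (c) and Thm. IV.5.5; FriedliVelenik2017, Thm. 3.34 and Thm. 3.43] -/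
theorem exp_concentration_of_hasUniqueGibbsMeasure (hd : 1 ≤ d) {β : ℝ} (hβ : 0 < β) {h : ℝ}
    (hU : HasUniqueGibbsMeasure (isingSpecification (zdGraph d) β h)) {ε : ℝ} (hε : 0 < ε) :
    ∃ c : ℝ, 0 < c ∧ ∀ bc : BoundaryCondition (Site d), ∀ᶠ N : ℕ in atTop,
      (isingMeasure (zdGraph d) (box d N) β h bc).real
          {σ | ε ≤ |(∑ x ∈ box d N, spinAt x σ) / #(box d N) - (Real.sign h * magnetizationInField d β |h|)|} ≤
        Real.exp (-(c * #(box d N))) := by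
  rcases lt_trichotomy h 0 with hneg | rfl | hpos
  · have h1 := exp_concentration_neg_field hd hβ hneg hε
    rw [Real.sign_of_neg hneg, abs_of_neg hneg]
    simpa only [neg_one_mul, sub_neg_eq_add] using h1
  · have hm : spontaneousMagnetization d β = 0 :=
      IsingSusceptibility.spontaneousMagnetization_eq_zero_of_hasUniqueGibbsMeasure (d := d) hβ.le hU
    have h1 := exp_concentration_zero_field_of_spontaneousMagnetization_eq_zero hd hβ hm hε
    simpa only [Real.sign_zero, zero_mul, sub_zero] using h1
  · have h1 := exp_concentration_pos_field hd hβ hpos hε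
    rwa [Real.sign_of_pos hpos, abs_of_pos hpos, one_mul]

/-- **AT `h = 0` AND `0 < β ≤ β_c(d)` (`d ≥ 2`): `M_N/|Λ_N| →exp 0`** under every boundary condition (`m*(β) = 0`
there: `|𝒢(β,0)| = 1` iff `β ≤ β_c`, including the critical point). [cite: Ellis2006, Thm. IV.5.5 (4.32) and Thm. V.6.1 (c); FriedliVelenik2017, Thm. 3.25 and Thm. 3.34] -/
theorem exp_concentration_zero_field_of_le_criticalBeta (hd : 2 ≤ d) {β : ℝ} (hβ : 0 < β)
    (hβc : β ≤ criticalBeta d) {ε : ℝ} (hε : 0 < ε) :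
    ∃ c : ℝ, 0 < c ∧ ∀ bc : BoundaryCondition (Site d), ∀ᶠ N : ℕ in atTop,
      (isingMeasure (zdGraph d) (box d N) β 0 bc).real
          {σ | ε ≤ |(∑ x ∈ box d N, spinAt x σ) / #(box d N)|} ≤ Real.exp (-(c * #(box d N))) :=
  exp_concentration_zero_field_of_spontaneousMagnetization_eq_zero (by omega) hβ
    (IsingSusceptibility.spontaneousMagnetization_eq_zero_of_hasUniqueGibbsMeasure (d := d) hβ.le
      ((IsingSusceptibility.hasUniqueGibbsMeasure_zero_field_iff hd hβ).2 hβc)) hε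

/-- **ON `{h ≠ 0} ∪ {β ≤ β_c(d)}` (`d ≥ 2`, `β > 0`) the magnetisation density converges exponentially to
`sign(h) m(β,|h|)` under every boundary condition** (the uniqueness region of the phase diagram,
`hasUniqueGibbsMeasure_iff`). [cite: Ellis2006, Thm. V.6.1 (b)–(c); FriedliVelenik2017, Thm. 3.25] -/
theorem exp_concentration_of_ne_zero_or_le_criticalBeta (hd : 2 ≤ d) {β : ℝ} (hβ : 0 < β) {h : ℝ}
    (hh : h ≠ 0 ∨ β ≤ criticalBeta d) {ε : ℝ} (hε : 0 < ε) :
    ∃ c : ℝ, 0 < c ∧ ∀ bc : BoundaryCondition (Site d), ∀ᶠ N : ℕ in atTop,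
      (isingMeasure (zdGraph d) (box d N) β h bc).real
          {σ | ε ≤ |(∑ x ∈ box d N, spinAt x σ) / #(box d N) - (Real.sign h * magnetizationInField d β |h|)|} ≤
        Real.exp (-(c * #(box d N))) :=
  exp_concentration_of_hasUniqueGibbsMeasure (by omega) hβ
    ((IsingSusceptibility.hasUniqueGibbsMeasure_iff hd hβ h).2 hh) hε

end IsingLargeDeviations

end Summit.CriticalPhenomena.PercolationContinuityZ3.Theorems.FK
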